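import Mathlib.Analysis.Distribution.SchwartzSpace.Basic
import Mathlib.Analysis.Calculus.MeanValue
import Mathlib.Analysis.Calculus.BumpFunction.FiniteDimension
import HarnessLib

/-!
# Schwartz space: continuity of translations and density of compactly supported functions

Trunk **T-AQFT** (support file for the Osterwalder–Schrader axioms in measure form,
`Literature.MathematicalPhysics.QuantumLattice.OSAxiomsMeasure`), families `constructive-qft`,
`crit-ising`.

Two standard facts about the Schwartz space `𝓢(E, F)` with its Fréchet topology
(Mathlib `SchwartzMap`, seminorms `SchwartzMap.seminorm 𝕜 k n f = sup ‖x‖ᵏ ‖Dⁿ f x‖`):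

* `Literature.MathematicalPhysics.QuantumLattice.continuous_compSubConstCLM`: for fixed `f ∈ 𝓢(E, F)` the translation orbit
  `a ↦ f (· - a)` (Mathlib `SchwartzMap.compSubConstCLM 𝕜 a f`) is continuous `E → 𝓢(E, F)`;
  quantitatively (`seminorm_compSubConstCLM_sub_le`)
  `p_{k,n}(f(· - a) - f) ≤ 4ᵏ (sup_{k' ≤ k, n' ≤ n+1} p_{k',n'}(f)) ‖a‖` for `‖a‖ ≤ 1`, by the mean
  value inequality applied to `Dⁿ f`.
* `Literature.MathematicalPhysics.QuantumLattice.exists_tsupport_subset_closedBall_tendsto`: every `f ∈ 𝓢(E, F)` (`E` finite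
  dimensional) is the limit in `𝓢(E, F)` of the bump cutoffs `χ(x/R) f(x)`, `R = m + 1 → ∞`,
  which are supported in `closedBall 0 (2R)` (and inside `tsupport f`:
  `exists_tsupport_subset_inter_closedBall_tendsto`); in particular compactly supported Schwartz
  functions are sequentially dense (`p_{k,n}(χ_R f - f) ≤ K/R` by the Leibniz bound
  `norm_iteratedFDeriv_smul_le` and `‖x‖ᵏ ≤ ‖x‖ᵏ⁺¹/R` off the ball of radius `R`).

These are used downstream for the strong continuity of the time-translation flow on `𝒮'` and for
approximating test functions by ones with time-bounded support (clustering from ergodicity,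
Glimm–Jaffe §19.7).

## Sources

* L. Hörmander, *The Analysis of Linear Partial Differential Operators I* (2nd ed. 1990),
  Lemma 7.1.8 (`C_c^∞` is dense in `𝒮`) and §7.1 (translation is continuous on `𝒮`). Both are
  textbook folklore; the proofs here are self-contained.

## Mathlib

Used: `SchwartzMap.compSubConstCLM`, `SchwartzMap.smulLeftCLM` (multiplication by a function of
temperate growth), `HasCompactSupport.hasTemperateGrowth`, `ContDiffBump`,
`schwartz_withSeminorms` / `WithSeminorms.tendsto_nhds`, `SchwartzMap.one_add_le_sup_seminorm_apply`,
`Convex.norm_image_sub_le_of_norm_fderiv_le`, `norm_fderiv_iteratedFDeriv`,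
`norm_iteratedFDeriv_smul_le`, `ContinuousLinearMap.iteratedFDeriv_comp_right`.
Searched and absent at the pin: continuity of `a ↦ compSubConstCLM 𝕜 a f`, density of compactly
supported functions in `𝓢` (`dense`, `bump`, `toSchwartz` in `Mathlib/Analysis/Distribution`).
-/

open scoped SchwartzMap Topology ContDiff
open Filter Set Metric

namespace Literature.MathematicalPhysics.QuantumLattice

/-! ### Continuity of translations -/

section Translation

variable (𝕜 : Type*) [RCLike 𝕜]
variable {E F : Type*} [NormedAddCommGroup E] [NormedSpace ℝ E] [NormedAddCommGroup F]
  [NormedSpace ℝ F] [NormedSpace 𝕜 F]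

/-- Quantitative continuity of translation at `0` in Schwartz space: for `‖a‖ ≤ 1`,
`p_{k,n}(f(· - a) - f) ≤ 2ᵏ·2ᵏ·(sup_{(k',n') ≤ (k,n+1)} p_{k',n'}(f))·‖a‖`. Mean value inequality
for `Dⁿ f` on the ball of radius `1` around `x`, plus `1 + ‖x‖ ≤ 2 (1 + ‖y‖)` there.
Hörmander I §7.1. [folklore] -/
theorem seminorm_compSubConstCLM_sub_le (f : 𝓢(E, F)) (k n : ℕ) {a : E} (ha : ‖a‖ ≤ 1) :
    SchwartzMap.seminorm ℝ k n (SchwartzMap.compSubConstCLM 𝕜 a f - f) ≤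
      2 ^ k * 2 ^ k * (Finset.Iic (k, n + 1)).sup (schwartzSeminormFamily ℝ E F) f * ‖a‖ := by
  set S := (Finset.Iic (k, n + 1)).sup (schwartzSeminormFamily ℝ E F) f with hS
  have hS0 : 0 ≤ S := apply_nonneg _ _
  refine SchwartzMap.seminorm_le_bound ℝ k n _ (by positivity) fun x => ?_
  have hderiv : iteratedFDeriv ℝ n (⇑(SchwartzMap.compSubConstCLM 𝕜 a f - f)) x =
      iteratedFDeriv ℝ n f (x - a) - iteratedFDeriv ℝ n f x := by
    have hcoe : (⇑(SchwartzMap.compSubConstCLM 𝕜 a f - f) : E → F) = (fun z => f (z - a)) - ⇑f :=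
      rfl
    rw [hcoe, iteratedFDeriv_sub_apply, iteratedFDeriv_comp_sub]
    · exact ((f.smooth n).comp (contDiff_id.sub contDiff_const)).contDiffAt
    · exact (f.smooth n).contDiffAt
  have hmvt : ‖iteratedFDeriv ℝ n f (x - a) - iteratedFDeriv ℝ n f x‖ ≤
      (2 ^ k * S * 2 ^ k / (1 + ‖x‖) ^ k) * ‖(x - a) - x‖ := by
    refine (convex_closedBall x 1).norm_image_sub_le_of_norm_fderiv_le (𝕜 := ℝ)
      (f := iteratedFDeriv ℝ n f) (fun y _ => ?_) (fun y hy => ?_)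
      (mem_closedBall_self zero_le_one) ?_
    · exact ((f.smooth ⊤).differentiable_iteratedFDeriv (m := n)
        (by exact_mod_cast ENat.coe_lt_top n)) y
    · rw [norm_fderiv_iteratedFDeriv]
      have h1 : (1 + ‖y‖) ^ k * ‖iteratedFDeriv ℝ (n + 1) f y‖ ≤ 2 ^ k * S :=
        SchwartzMap.one_add_le_sup_seminorm_apply (𝕜 := ℝ) (m := (k, n + 1)) le_rfl le_rfl f y
      have hxy : 1 + ‖x‖ ≤ 2 * (1 + ‖y‖) := by
        have hd : ‖y - x‖ ≤ 1 := by rw [← dist_eq_norm]; exact mem_closedBall.1 hy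
        have : ‖x‖ ≤ ‖y‖ + ‖y - x‖ := by
          calc ‖x‖ = ‖y - (y - x)‖ := by rw [sub_sub_cancel]
            _ ≤ ‖y‖ + ‖y - x‖ := norm_sub_le _ _
        linarith [norm_nonneg y]
      have hpow : (1 + ‖x‖) ^ k ≤ 2 ^ k * (1 + ‖y‖) ^ k := by
        rw [← mul_pow]; exact pow_le_pow_left₀ (by positivity) hxy k
      rw [le_div_iff₀ (by positivity)]
      calc ‖iteratedFDeriv ℝ (n + 1) f y‖ * (1 + ‖x‖) ^ k
          ≤ ‖iteratedFDeriv ℝ (n + 1) f y‖ * (2 ^ k * (1 + ‖y‖) ^ k) :=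
            mul_le_mul_of_nonneg_left hpow (norm_nonneg _)
        _ = 2 ^ k * ((1 + ‖y‖) ^ k * ‖iteratedFDeriv ℝ (n + 1) f y‖) := by ring
        _ ≤ 2 ^ k * (2 ^ k * S) := mul_le_mul_of_nonneg_left h1 (by positivity)
        _ = 2 ^ k * S * 2 ^ k := by ring
    · rw [mem_closedBall, dist_eq_norm, sub_sub_cancel_left, norm_neg]; exact ha
  rw [hderiv]
  have hxa : ‖(x - a) - x‖ = ‖a‖ := by rw [sub_sub_cancel_left, norm_neg]
  rw [hxa] at hmvt
  have hxk : ‖x‖ ^ k ≤ (1 + ‖x‖) ^ k :=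
    pow_le_pow_left₀ (norm_nonneg _) (by linarith [norm_nonneg x]) k
  have hpos : (0 : ℝ) < (1 + ‖x‖) ^ k := by positivity
  calc ‖x‖ ^ k * ‖iteratedFDeriv ℝ n f (x - a) - iteratedFDeriv ℝ n f x‖
      ≤ (1 + ‖x‖) ^ k * (2 ^ k * S * 2 ^ k / (1 + ‖x‖) ^ k * ‖a‖) :=
        mul_le_mul hxk hmvt (norm_nonneg _) (by positivity)
    _ = 2 ^ k * 2 ^ k * S * ‖a‖ := by field_simp

/-- Translation is continuous at `0` on Schwartz space: `f(· - a) → f` in `𝓢(E, F)` as `a → 0`.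
Hörmander I §7.1. [folklore] -/
theorem tendsto_compSubConstCLM_nhds_zero (f : 𝓢(E, F)) :
    Tendsto (fun a : E => SchwartzMap.compSubConstCLM 𝕜 a f) (𝓝 0) (𝓝 f) := by
  rw [(schwartz_withSeminorms ℝ E F).tendsto_nhds]
  rintro ⟨k, n⟩ ε hε
  set K := 2 ^ k * 2 ^ k * (Finset.Iic (k, n + 1)).sup (schwartzSeminormFamily ℝ E F) f with hK
  have hK0 : 0 ≤ K := by positivity
  have hδ : 0 < min 1 (ε / (K + 1)) := lt_min one_pos (div_pos hε (by linarith))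
  filter_upwards [Metric.ball_mem_nhds (0 : E) hδ] with a ha
  rw [mem_ball_zero_iff, lt_min_iff] at ha
  rw [SchwartzMap.schwartzSeminormFamily_apply]
  calc SchwartzMap.seminorm ℝ k n (SchwartzMap.compSubConstCLM 𝕜 a f - f) ≤ K * ‖a‖ :=
        seminorm_compSubConstCLM_sub_le 𝕜 f k n ha.1.le
    _ ≤ K * (ε / (K + 1)) := by gcongr; exact ha.2.le
    _ < ε := by
        rw [mul_div_assoc', div_lt_iff₀ (by linarith)]
        nlinarith

/-- For fixed `f ∈ 𝓢(E, F)`, the translation orbit `a ↦ f(· - a)` is continuous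
`E → 𝓢(E, F)` (strong continuity of the translation group on Schwartz space).
Hörmander I §7.1. [folklore] -/
theorem continuous_compSubConstCLM (f : 𝓢(E, F)) :
    Continuous fun a : E => SchwartzMap.compSubConstCLM 𝕜 a f := by
  refine continuous_iff_continuousAt.2 fun a₀ => ?_
  have h : (fun a : E => SchwartzMap.compSubConstCLM 𝕜 a f) =
      fun a => SchwartzMap.compSubConstCLM 𝕜 a₀ (SchwartzMap.compSubConstCLM 𝕜 (a - a₀) f) := by
    funext a
    rw [SchwartzMap.compSubConstCLM_comp, sub_add_cancel]
  rw [ContinuousAt, h]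
  refine ((SchwartzMap.compSubConstCLM 𝕜 a₀).continuous.tendsto f).comp ?_
  have h0 : Tendsto (fun a : E => a - a₀) (𝓝 a₀) (𝓝 0) := by
    simpa using (tendsto_id (x := 𝓝 a₀)).sub_const a₀
  exact (tendsto_compSubConstCLM_nhds_zero 𝕜 f).comp h0

end Translation

/-! ### Density of compactly supported Schwartz functions -/

section Cutoff

variable {E F : Type*} [NormedAddCommGroup E] [NormedSpace ℝ E]
  [NormedAddCommGroup F] [NormedSpace ℝ F]

/-- Precomposition with a continuous linear map of norm `≤ 1` does not increase the norm of the
iterated derivative: `‖Dⁱ(g ∘ L) x‖ ≤ ‖Dⁱ g (L x)‖`. [folklore] -/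
theorem norm_iteratedFDeriv_comp_clm_le {G : Type*} [NormedAddCommGroup G] [NormedSpace ℝ G]
    {g : E → G} (hg : ContDiff ℝ ∞ g) (L : E →L[ℝ] E) (hL : ‖L‖ ≤ 1) (i : ℕ) (x : E) :
    ‖iteratedFDeriv ℝ i (g ∘ L) x‖ ≤ ‖iteratedFDeriv ℝ i g (L x)‖ := by
  rw [L.iteratedFDeriv_comp_right hg x (by exact_mod_cast le_top)]
  refine (ContinuousMultilinearMap.norm_compContinuousLinearMap_le _ _).trans ?_
  refine mul_le_of_le_one_right (norm_nonneg _) ?_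
  exact Finset.prod_le_one (fun _ _ => norm_nonneg _) fun _ _ => hL

variable [FiniteDimensional ℝ E]

/-- **Compact cutoffs converge in `𝓢(E, F)`** (`E` finite dimensional): for every `f ∈ 𝓢(E, F)`
there is a sequence `u m` of Schwartz functions with
`tsupport (u m) ⊆ tsupport f ∩ closedBall 0 (2 (m + 1))` and `u m → f` in the Schwartz topology.
The `u m` are the bump cutoffs `x ↦ χ(x / (m + 1)) f(x)` for a fixed smooth bump `χ` equal to `1`
on the unit ball and supported in the ball of radius `2` (so they vanish wherever `f` does).
Hörmander I, Lemma 7.1.8. [folklore] -/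
theorem exists_tsupport_subset_inter_closedBall_tendsto (f : 𝓢(E, F)) :
    ∃ u : ℕ → 𝓢(E, F),
      (∀ m : ℕ, tsupport (u m : E → F) ⊆
        tsupport (f : E → F) ∩ closedBall (0 : E) (2 * ((m : ℝ) + 1))) ∧
        Tendsto u atTop (𝓝 f) := by
  let χ : ContDiffBump (0 : E) := ⟨1, 2, one_pos, one_lt_two⟩
  have hR : ∀ m : ℕ, (0 : ℝ) < m + 1 := fun m => by positivity
  let L : ℕ → E →L[ℝ] E := fun m => ((m : ℝ) + 1)⁻¹ • ContinuousLinearMap.id ℝ E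
  let χR : ℕ → E → ℝ := fun m => (χ : E → ℝ) ∘ L m
  have hχR_apply : ∀ m x, χR m x = χ (((m : ℝ) + 1)⁻¹ • x) := fun m x => rfl
  have hχ_smooth : ContDiff ℝ ∞ (χ : E → ℝ) := χ.contDiff
  have hχR_smooth : ∀ m, ContDiff ℝ ∞ (χR m) := fun m => hχ_smooth.comp (L m).contDiff
  have hχR_zero : ∀ (m : ℕ) (x : E), 2 * ((m : ℝ) + 1) < ‖x‖ → χR m x = 0 := by
    intro m x hx
    have hx' : ((m : ℝ) + 1)⁻¹ • x ∉ Function.support (χ : E → ℝ) := by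
      rw [χ.support_eq, mem_ball_zero_iff, norm_smul, norm_inv, Real.norm_of_nonneg (hR m).le,
        not_lt, le_inv_mul_iff₀ (hR m)]
      change ((m : ℝ) + 1) * 2 ≤ ‖x‖
      linarith
    rw [Function.mem_support, not_not] at hx'
    exact hx'
  have hχR_one : ∀ (m : ℕ) (x : E), ‖x‖ ≤ (m : ℝ) + 1 → χR m x = 1 := by
    intro m x hx
    apply χ.one_of_mem_closedBall
    change ((m : ℝ) + 1)⁻¹ • x ∈ closedBall (0 : E) 1
    rw [mem_closedBall_zero_iff, norm_smul, norm_inv, Real.norm_of_nonneg (hR m).le,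
      inv_mul_le_iff₀ (hR m), mul_one]
    exact hx
  have hχR_supp : ∀ m, HasCompactSupport (χR m) := fun m =>
    HasCompactSupport.intro (isCompact_closedBall (0 : E) (2 * ((m : ℝ) + 1))) fun x hx =>
      hχR_zero m x (by simpa [mem_closedBall_zero_iff] using hx)
  have hχR_temp : ∀ m, (χR m).HasTemperateGrowth := fun m =>
    (hχR_supp m).hasTemperateGrowth (hχR_smooth m)
  refine ⟨fun m => SchwartzMap.smulLeftCLM F (χR m) f, fun m => ?_, ?_⟩
  · refine (SchwartzMap.tsupport_smulLeftCLM_subset _ _).trans (Set.inter_subset_inter_right _ ?_)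
    refine closure_minimal (fun x hx => ?_) isClosed_closedBall
    by_contra h
    exact hx (hχR_zero m x (by simpa [mem_closedBall_zero_iff] using h))
  -- uniform bounds on the derivatives of the bump and its rescalings
  have hM : ∀ i : ℕ, ∃ M : ℝ, ∀ y, ‖iteratedFDeriv ℝ i (χ : E → ℝ) y‖ ≤ M := fun i => by
    obtain ⟨x₀, hx₀⟩ := ((hχ_smooth.continuous_iteratedFDeriv (m := i)
      (by exact_mod_cast le_top)).norm).exists_forall_ge_of_hasCompactSupport
      ((χ.hasCompactSupport.iteratedFDeriv i).norm)
    exact ⟨_, hx₀⟩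
  choose M hM using hM
  have hM0 : ∀ i, 0 ≤ M i := fun i => (norm_nonneg _).trans (hM i 0)
  have hL1 : ∀ m, ‖L m‖ ≤ 1 := by
    intro m
    change ‖((m : ℝ) + 1)⁻¹ • ContinuousLinearMap.id ℝ E‖ ≤ 1
    refine (ContinuousLinearMap.opNorm_smul_le _ _).trans ?_
    rw [norm_inv, Real.norm_of_nonneg (hR m).le]
    calc ((m : ℝ) + 1)⁻¹ * ‖ContinuousLinearMap.id ℝ E‖ ≤ 1 * 1 :=
          mul_le_mul (inv_le_one_of_one_le₀ (by linarith [(m.cast_nonneg : (0 : ℝ) ≤ m)]))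
            ContinuousLinearMap.norm_id_le (norm_nonneg _) zero_le_one
      _ = 1 := one_mul 1
  have hDχR : ∀ m i x, ‖iteratedFDeriv ℝ i (χR m) x‖ ≤ M i := fun m i x =>
    (norm_iteratedFDeriv_comp_clm_le hχ_smooth (L m) (hL1 m) i x).trans (hM i _)
  have hDψ : ∀ m i x, ‖iteratedFDeriv ℝ i (fun y => χR m y - 1) x‖ ≤ M i + 1 := by
    intro m i x
    have hsub : (fun y => χR m y - 1) = χR m - fun _ => (1 : ℝ) := rfl
    rw [hsub, iteratedFDeriv_sub_apply ((hχR_smooth m).of_le (by exact_mod_cast le_top)).contDiffAt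
      contDiffAt_const]
    refine (norm_sub_le _ _).trans (add_le_add (hDχR m i x) ?_)
    rcases Nat.eq_zero_or_pos i with rfl | hi
    · rw [norm_iteratedFDeriv_zero]; simp
    · rw [iteratedFDeriv_const_of_ne (Nat.pos_iff_ne_zero.1 hi)]; simp
  -- pointwise identification of `u m - f`
  have hcoe : ∀ m, (⇑(SchwartzMap.smulLeftCLM F (χR m) f - f) : E → F) =
      fun x => (χR m x - 1) • f x := by
    intro m
    funext x
    simp only [sub_apply, SchwartzMap.smulLeftCLM_apply_apply (hχR_temp m), sub_smul,
      one_smul]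
  -- the seminorm estimate `p_{k,n}(u m - f) ≤ K / (m + 1)`
  have hest : ∀ k n : ℕ, ∃ K : ℝ, 0 ≤ K ∧ ∀ m : ℕ,
      SchwartzMap.seminorm ℝ k n (SchwartzMap.smulLeftCLM F (χR m) f - f) ≤ K / ((m : ℝ) + 1) := by
    intro k n
    set S' := (Finset.Iic (k + 1, n)).sup (schwartzSeminormFamily ℝ E F) f with hS'
    have hS'0 : 0 ≤ S' := apply_nonneg _ _
    set K := (∑ i ∈ Finset.range (n + 1), (n.choose i : ℝ) * (M i + 1)) * S' with hK
    have hK0 : 0 ≤ K := by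
      refine mul_nonneg (Finset.sum_nonneg fun i _ => ?_) hS'0
      have := hM0 i
      positivity
    refine ⟨K, hK0, fun m => ?_⟩
    refine SchwartzMap.seminorm_le_bound ℝ k n _ (by positivity) fun x => ?_
    rw [hcoe m]
    by_cases hx : ‖x‖ < (m : ℝ) + 1
    · -- inside the ball the cutoff is `1`, so `u m - f` vanishes near `x`
      have hsupp : Function.support (fun y => (χR m y - 1) • f y) ⊆ (ball (0 : E) ((m : ℝ) + 1))ᶜ := by
        intro y hy
        rw [mem_compl_iff, mem_ball_zero_iff, not_lt]
        by_contra h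
        push Not at h
        exact hy (by change (χR m y - 1) • f y = 0; rw [hχR_one m y h.le, sub_self, zero_smul])
      have hx' : x ∉ tsupport (fun y => (χR m y - 1) • f y) := fun h =>
        (closure_minimal hsupp isOpen_ball.isClosed_compl h) (mem_ball_zero_iff.2 hx)
      have h0 : iteratedFDeriv ℝ n (fun y => (χR m y - 1) • f y) x = 0 :=
        Function.notMem_support.1 fun h => hx' (support_iteratedFDeriv_subset n h)
      rw [h0, norm_zero, mul_zero]
      positivity
    · push Not at hx
      have hxpos : 0 < ‖x‖ := (hR m).trans_le hx
      have hψ : ContDiff ℝ n (fun y => χR m y - 1) :=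
        ((hχR_smooth m).sub contDiff_const).of_le (by exact_mod_cast le_top)
      have hleib := norm_iteratedFDeriv_smul_le (𝕜 := ℝ) hψ (f.smooth n) x (n := n) le_rfl
      have hterm : ∀ i ∈ Finset.range (n + 1),
          ‖x‖ ^ k * ((n.choose i : ℝ) * ‖iteratedFDeriv ℝ i (fun y => χR m y - 1) x‖ *
            ‖iteratedFDeriv ℝ (n - i) f x‖) ≤ (n.choose i : ℝ) * (M i + 1) * (S' / ((m : ℝ) + 1)) := by
        intro i _
        have h1 : ‖x‖ ^ k * ‖iteratedFDeriv ℝ (n - i) f x‖ ≤ S' / ((m : ℝ) + 1) := by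
          rw [le_div_iff₀ (hR m)]
          have h2 : ‖x‖ ^ (k + 1) * ‖iteratedFDeriv ℝ (n - i) f x‖ ≤ S' :=
            (SchwartzMap.le_seminorm ℝ (k + 1) (n - i) f x).trans
              (Seminorm.le_def.1 (Finset.le_sup (f := schwartzSeminormFamily ℝ E F)
                (Finset.mem_Iic.2 (Prod.mk_le_mk.2 ⟨le_rfl, Nat.sub_le n i⟩))) f)
          calc ‖x‖ ^ k * ‖iteratedFDeriv ℝ (n - i) f x‖ * ((m : ℝ) + 1)
              ≤ ‖x‖ ^ k * ‖iteratedFDeriv ℝ (n - i) f x‖ * ‖x‖ := by gcongr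
            _ = ‖x‖ ^ (k + 1) * ‖iteratedFDeriv ℝ (n - i) f x‖ := by ring
            _ ≤ S' := h2
        calc ‖x‖ ^ k * ((n.choose i : ℝ) * ‖iteratedFDeriv ℝ i (fun y => χR m y - 1) x‖ *
              ‖iteratedFDeriv ℝ (n - i) f x‖)
            = (n.choose i : ℝ) * ‖iteratedFDeriv ℝ i (fun y => χR m y - 1) x‖ *
                (‖x‖ ^ k * ‖iteratedFDeriv ℝ (n - i) f x‖) := by ring
          _ ≤ (n.choose i : ℝ) * (M i + 1) * (S' / ((m : ℝ) + 1)) :=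
              mul_le_mul (mul_le_mul_of_nonneg_left (hDψ m i x) (by positivity)) h1
                (by positivity) (by have := hM0 i; positivity)
      calc ‖x‖ ^ k * ‖iteratedFDeriv ℝ n (fun y => (χR m y - 1) • f y) x‖
          ≤ ‖x‖ ^ k * ∑ i ∈ Finset.range (n + 1), (n.choose i : ℝ) *
              ‖iteratedFDeriv ℝ i (fun y => χR m y - 1) x‖ * ‖iteratedFDeriv ℝ (n - i) f x‖ := by
            gcongr
        _ = ∑ i ∈ Finset.range (n + 1), ‖x‖ ^ k * ((n.choose i : ℝ) *
              ‖iteratedFDeriv ℝ i (fun y => χR m y - 1) x‖ * ‖iteratedFDeriv ℝ (n - i) f x‖) := by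
            rw [Finset.mul_sum]
        _ ≤ ∑ i ∈ Finset.range (n + 1), (n.choose i : ℝ) * (M i + 1) * (S' / ((m : ℝ) + 1)) :=
            Finset.sum_le_sum hterm
        _ = K / ((m : ℝ) + 1) := by
            rw [hK, ← Finset.sum_mul]
            ring
  -- conclusion
  rw [(schwartz_withSeminorms ℝ E F).tendsto_nhds_atTop]
  rintro ⟨k, n⟩ ε hε
  obtain ⟨K, hK0, hK⟩ := hest k n
  refine ⟨⌈K / ε⌉₊, fun m hm => ?_⟩
  rw [SchwartzMap.schwartzSeminormFamily_apply]
  have hm' : K / ε < (m : ℝ) + 1 :=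
    (Nat.le_ceil _).trans_lt (by exact_mod_cast Nat.lt_succ_of_le hm)
  calc SchwartzMap.seminorm ℝ k n (SchwartzMap.smulLeftCLM F (χR m) f - f) ≤ K / ((m : ℝ) + 1) :=
        hK m
    _ < ε := by
        rw [div_lt_iff₀ (hR m)]
        rw [div_lt_iff₀ hε] at hm'
        linarith

/-- **Compactly supported Schwartz functions are (sequentially) dense in `𝓢(E, F)`** for a
finite-dimensional `E`: for every `f ∈ 𝓢(E, F)` there is a sequence `u m` of Schwartz functions
with `tsupport (u m) ⊆ closedBall 0 (2 (m + 1))` and `u m → f` in the Schwartz topology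
(the bump cutoffs of `exists_tsupport_subset_inter_closedBall_tendsto`, forgetting that they are
also supported inside `tsupport f`). Hörmander I, Lemma 7.1.8. [folklore] -/
theorem exists_tsupport_subset_closedBall_tendsto (f : 𝓢(E, F)) :
    ∃ u : ℕ → 𝓢(E, F),
      (∀ m : ℕ, tsupport (u m : E → F) ⊆ closedBall (0 : E) (2 * ((m : ℝ) + 1))) ∧
        Tendsto u atTop (𝓝 f) := by
  obtain ⟨u, hu, hlim⟩ := exists_tsupport_subset_inter_closedBall_tendsto f
  exact ⟨u, fun m => (hu m).trans Set.inter_subset_right, hlim⟩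

/-- Compactly supported Schwartz functions are sequentially dense in `𝓢(E, F)` (`E` finite
dimensional). Hörmander I, Lemma 7.1.8. [folklore] -/
theorem exists_hasCompactSupport_tendsto (f : 𝓢(E, F)) :
    ∃ u : ℕ → 𝓢(E, F), (∀ m, HasCompactSupport (u m : E → F)) ∧ Tendsto u atTop (𝓝 f) := by
  obtain ⟨u, hu, hlim⟩ := exists_tsupport_subset_closedBall_tendsto f
  exact ⟨u, fun m => IsCompact.of_isClosed_subset (isCompact_closedBall _ _) (isClosed_tsupport _)
    (hu m), hlim⟩

end Cutoff

end Literature.MathematicalPhysics.QuantumLattice
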